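import Literature.AlgebraicGeometry.Frobenioids.ArchimedeanFSM
import Literature.AlgebraicGeometry.Frobenioids.CategoriesFactorizationRevised
import Literature.AlgebraicGeometry.Frobenioids.FSMIMorphisms
import HarnessLib

/-!
# Frobenioids II, Proposition 3.4 (viii): the chain bound (condition (b) of FSMFF-type) for `F`,
# transferred along the tower `F → D`, `F → F₀`
# (abc-iut cell, layer L1, sub-node `FrdII:Prop3.4(viii)/P34-L13` "FChainBound" of
# `plan/L1/SUBDAG-FrdII-Prop34.md`)

Mochizuki, *The geometry of Frobenioids II: poly-Frobenioids*, Kyushu J. Math. **62** (2008)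
401–460, §3, Proposition 3.4 (viii) p. 30, proof p. 33 ll. 3–15 [cite: MochizukiFrdII2008, Prop 3.4 (viii) p.33]:

> "Next, let `φₙ ∘ φₙ₋₁ ∘ … ∘ φ₂ ∘ φ₁` be a composite of FSMI-morphisms of `F`. By assertion (vi), it follows
> that each of the `φᵢ` (for `i = 1, …, n`) projects to either an isomorphism or an FSMI-morphism of `D`.
> Since `D` is of FSMFF-type, it thus follows that there exists a positive integer `N` (independent of `n`)
> such that the number of `i` for which `φᵢ` does not project to an isomorphism of `D` is `≤ N`. On the
> other hand, by assertion (iv), the `φᵢ` that project to isomorphisms of `D` project to FSMI-morphisms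
> of `F₀`. Thus [by the portion of assertion (viii) concerning `F₀`] we conclude that there exists a
> positive integer `N'` (independent of `n`) such that the number of `i` for which `φᵢ` projects to an
> isomorphism of `D` is `≤ N'`. Therefore `n ≤ N + N'` …"

This PROOF-ONLY file (nothing is defined) carries out that count with the author's REVISED (2024)
condition (b) of "FSMFF-type" (*Comments on "The geometry of Frobenioids I"*, item (28): composites
out of `A` with ARBITRARY head and FSMI tail have bounded length — the landed
`IsOfFSMFFType2024` / `IsHeadedFSMIChain ⊤` of `CategoriesFactorizationRevised.lean`), which is the form
that makes the transfer along the two projections purely formal: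

* `IsHeadedFSMIChain.length_le_of_functors` — the ABSTRACT transfer: for functors `G : F ⥤ D`,
  `H : F ⥤ F₀` such that (vi) every FSMI-morphism of `F` maps under `G` to an isomorphism or an
  FSMI-morphism and (iv) every FSMI-morphism of `F` mapping to an isomorphism under `G` maps to an
  FSMI-morphism under `H`, a bound `N_D` for the headed chains out of `G A` in `D` and a bound `N₀`
  for the headed chains out of `H A` in `F₀` give the bound `N_D · N₀` for the headed chains out of
  `A` in `F`. (The abstract count: the tail members mapping to FSMI-morphisms of `D` are at most
  `N_D − 1` in number — isomorphisms of `D` are absorbed into the neighbouring FSMI-morphisms — and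
  they cut the remaining tail members into at most `N_D` maximal runs, each of which maps under `H`
  to a chain of FSMI-morphisms of `F₀` continuing an arrow out of `H A`, hence has length `≤ N₀ − 1`.
  With the revised condition the bound for `F₀` applies to each run separately; this yields the
  multiplicative bound rather than the printed "`N + N'`", which is immaterial for condition (b).)
* `IsOfFSMFFType2024.of_functors` — packaging: (a) for `F` (taken as a hypothesis) + the above ⇒
  `F` is of FSMFF-type (revised), hence of FSMFF-type as printed in 2008.
* the instances for a tower `T : ArchFrd.Tower π` of Prop. 3.4 (`ArchimedeanFSM.lean`, seat
  abc-iut-L1-t6): `ArchFrd.Tower.headedChain_length_le`, `ArchFrd.Tower.exists_headedChain_bound`,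
  `ArchFrd.Tower.isOfFSMFFType2024_of_chainBounds`, `ArchFrd.Tower.isOfFSMFFType_of_chainBounds`,
  consuming the typed "in particular" clause `T.PropVI_FSMI` of (vi) and the FSMI half of the typed
  item `T.PropIV` (under "`D` complexifiable", `ArchFrd.Tower.isFSMI_toF0_of_propIV`); the chain
  bound for `F₀` (sub-nodes P34-L10–L12) and condition (a) for `F` (P34-L14) enter BY NAME as
  hypotheses — no `Prop` is introduced here.

The typed item (viii) as a whole is REFUTED as typed at `π = 𝟭 D₀` (`ArchFrd.not_prop34_viii_id`,
`ArchimedeanFSMFFCounterexample.lean`, via clause (a) for `N`); nothing here bears on that: this file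
only supplies the (b)-half of the FSMFF conclusion from its printed inputs. No side is taken on
[IUTchIII] Cor. 3.12; typed ≠ proved elsewhere, but everything in THIS file is proved.
-/

namespace Literature.AlgebraicGeometry.Frobenioids

open CategoryTheory

universe v₁ v₂ v₃ u₁ u₂ u₃

section ChainTools

variable {C : Type u₁} [Category.{v₁} C]

/-- Appending an FSMI-morphism at the END of a chain of `m` FSMI-morphisms gives a chain of `m + 1`
FSMI-morphisms. [cite: MochizukiFrdI2008, §0 p.17] -/
theorem IsFSMIChain.snoc {A B : C} {χ : A ⟶ B} {m : ℕ} (h : IsFSMIChain χ m) :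
    ∀ {B' : C} {ψ : B ⟶ B'}, IsFSMI ψ → IsFSMIChain (χ ≫ ψ) (m + 1) := by
  induction h with
  | single φ hφ =>
    intro B' ψ hψ
    exact IsFSMIChain.cons φ ψ 1 hφ (IsFSMIChain.single ψ hψ)
  | cons φ χ n hφ _ ih =>
    intro B' ψ hψ
    rw [Category.assoc]
    exact IsFSMIChain.cons φ _ (n + 1) hφ (ih hψ)

/-- Appending an FSMI-morphism at the end of a headed chain of length `n` gives a headed chain of
length `n + 1` with the same head. [cite: MochizukiFrdIComments2024, (28) p.3] -/
theorem IsHeadedFSMIChain.snoc {P : MorphismProperty C} {A B : C} {φ : A ⟶ B} {n : ℕ}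
    (h : IsHeadedFSMIChain P φ n) {B' : C} {ψ : B ⟶ B'} (hψ : IsFSMI ψ) :
    IsHeadedFSMIChain P (φ ≫ ψ) (n + 1) := by
  cases h with
  | single φ hφ => exact IsHeadedFSMIChain.comp φ ψ 1 hφ (IsFSMIChain.single ψ hψ)
  | comp φ₁ χ m hφ₁ hχ =>
    rw [Category.assoc]
    exact IsHeadedFSMIChain.comp φ₁ _ (m + 1) hφ₁ (hχ.snoc hψ)

/-- A headed chain with ARBITRARY head (`P = ⊤`) absorbs an isomorphism at the end (into the head if
the chain has no tail, else into the last FSMI-morphism). [cite: MochizukiFrdIComments2024, (28) p.3] -/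
theorem IsHeadedFSMIChain.comp_iso_top {A B B' : C} {φ : A ⟶ B} {n : ℕ}
    (h : IsHeadedFSMIChain ⊤ φ n) (e : B ⟶ B') [IsIso e] :
    IsHeadedFSMIChain ⊤ (φ ≫ e) n := by
  cases h with
  | single φ _ => exact IsHeadedFSMIChain.single _ (MorphismProperty.top_apply _)
  | comp φ₁ χ m _ hχ =>
    rw [Category.assoc]
    exact IsHeadedFSMIChain.comp φ₁ _ m (MorphismProperty.top_apply _) (hχ.comp_iso (asIso e))

/-- A bound on headed chains with arbitrary head out of `A` is at least `1` (the identity of `A` is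
such a chain). [cite: MochizukiFrdIComments2024, (28) p.3] -/
theorem one_le_of_headedChain_bound {A : C} {N : ℕ}
    (hN : ∀ {B : C} (φ : A ⟶ B) (n : ℕ), IsHeadedFSMIChain ⊤ φ n → n ≤ N) : 1 ≤ N :=
  hN (𝟙 A) 1 (IsHeadedFSMIChain.single _ (MorphismProperty.top_apply _))

end ChainTools

/-! ### The abstract transfer along two functors -/

section Transfer

variable {F : Type u₁} [Category.{v₁} F] {D : Type u₂} [Category.{v₂} D]
  {F₀ : Type u₃} [Category.{v₃} F₀] (G : F ⥤ D) (H : F ⥤ F₀)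

/-- The inductive core of the count of [FrdII] Prop. 3.4 (viii), p. 33 ll. 3–15, along a chain
`χ = ψ₁ ≫ ⋯ ≫ ψₘ` of FSMI-morphisms of `F` continuing a prefix `f : A → X`: if the prefix already
contains `p` tail members, its image under `G` is a headed chain with `j` FSMI tail members, its
trailing run of members mapping to isomorphisms of `D` has length `k` (and maps under `H` to a chain
of `k` FSMI-morphisms of `F₀` continuing an arrow out of `H A`), and `p ≤ j · N₀ + k`, then the full
chain has `p + m + 1 ≤ N_D · N₀` members. [cite: MochizukiFrdII2008, Prop 3.4 (viii) p.33] -/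
private theorem transfer_aux
    (hVI : ∀ {X Y : F} (φ : X ⟶ Y), IsFSMI φ → IsIso (G.map φ) ∨ IsFSMI (G.map φ))
    (hIV : ∀ {X Y : F} (φ : X ⟶ Y), IsFSMI φ → IsIso (G.map φ) → IsFSMI (H.map φ))
    (A : F) {N_D N₀ : ℕ}
    (hD : ∀ {B : D} (φ : G.obj A ⟶ B) (n : ℕ), IsHeadedFSMIChain ⊤ φ n → n ≤ N_D)
    (h₀ : ∀ {B : F₀} (φ : H.obj A ⟶ B) (n : ℕ), IsHeadedFSMIChain ⊤ φ n → n ≤ N₀)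
    {X B : F} {χ : X ⟶ B} {m : ℕ} (hχ : IsFSMIChain χ m) :
    ∀ (f : A ⟶ X) (p j k : ℕ),
      IsHeadedFSMIChain ⊤ (G.map f) (j + 1) →
      (k = 0 ∨ ∃ (Y : F) (g : A ⟶ Y) (ρ : Y ⟶ X), g ≫ ρ = f ∧ IsFSMIChain (H.map ρ) k) →
      p ≤ j * N₀ + k → p + m + 1 ≤ N_D * N₀ := by
  -- the two numerical facts extracted from the invariants
  have hk_le : ∀ {X : F} (f : A ⟶ X) (k : ℕ),
      (k = 0 ∨ ∃ (Y : F) (g : A ⟶ Y) (ρ : Y ⟶ X), g ≫ ρ = f ∧ IsFSMIChain (H.map ρ) k) →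
      k + 1 ≤ N₀ := by
    intro X f k hk
    rcases hk with rfl | ⟨Y, g, ρ, -, hρ⟩
    · exact one_le_of_headedChain_bound h₀
    · exact h₀ _ _ (IsHeadedFSMIChain.comp (H.map g) (H.map ρ) k (MorphismProperty.top_apply _) hρ)
  have hfinal : ∀ {X : F} (f : A ⟶ X) (p j k : ℕ),
      IsHeadedFSMIChain ⊤ (G.map f) (j + 1) →
      (k = 0 ∨ ∃ (Y : F) (g : A ⟶ Y) (ρ : Y ⟶ X), g ≫ ρ = f ∧ IsFSMIChain (H.map ρ) k) →
      p ≤ j * N₀ + k → p + 1 ≤ N_D * N₀ := by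
    intro X f p j k h1 h2 h3
    have hj : j + 1 ≤ N_D := hD _ _ h1
    have hk : k + 1 ≤ N₀ := hk_le f k h2
    calc p + 1 ≤ j * N₀ + (k + 1) := by omega
      _ ≤ j * N₀ + N₀ := by omega
      _ = (j + 1) * N₀ := by ring
      _ ≤ N_D * N₀ := Nat.mul_le_mul_right _ hj
  -- one step: extend the prefix by an FSMI-morphism `ψ`, keeping the invariants
  have hstep : ∀ {X X' : F} (f : A ⟶ X) (ψ : X ⟶ X') (p j k : ℕ), IsFSMI ψ →
      IsHeadedFSMIChain ⊤ (G.map f) (j + 1) →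
      (k = 0 ∨ ∃ (Y : F) (g : A ⟶ Y) (ρ : Y ⟶ X), g ≫ ρ = f ∧ IsFSMIChain (H.map ρ) k) →
      p ≤ j * N₀ + k →
      ∃ j' k' : ℕ, IsHeadedFSMIChain ⊤ (G.map (f ≫ ψ)) (j' + 1) ∧
        (k' = 0 ∨ ∃ (Y : F) (g : A ⟶ Y) (ρ : Y ⟶ X'), g ≫ ρ = f ≫ ψ ∧ IsFSMIChain (H.map ρ) k') ∧
        p + 1 ≤ j' * N₀ + k' := by
    intro X X' f ψ p j k hψ h1 h2 h3
    rcases hVI ψ hψ with hiso | hfsmi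
    · -- `ψ` maps to an isomorphism of `D`: the trailing run grows by one
      refine ⟨j, k + 1, ?_, Or.inr ?_, by omega⟩
      · rw [G.map_comp]
        haveI := hiso
        exact h1.comp_iso_top (G.map ψ)
      · rcases h2 with rfl | ⟨Y, g, ρ, hgρ, hρ⟩
        · exact ⟨X, f, ψ, rfl, IsFSMIChain.single _ (hIV ψ hψ hiso)⟩
        · refine ⟨Y, g, ρ ≫ ψ, by rw [← Category.assoc, hgρ], ?_⟩
          rw [H.map_comp]
          exact hρ.snoc (hIV ψ hψ hiso)
    · -- `ψ` maps to an FSMI-morphism of `D`: one more FSMI tail member in `D`, the run restarts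
      have hk : k + 1 ≤ N₀ := hk_le f k h2
      refine ⟨j + 1, 0, ?_, Or.inl rfl, ?_⟩
      · rw [G.map_comp]
        exact h1.snoc hfsmi
      · calc p + 1 ≤ j * N₀ + (k + 1) := by omega
          _ ≤ j * N₀ + N₀ := by omega
          _ = (j + 1) * N₀ + 0 := by ring
  -- induction along the chain
  induction hχ with
  | single ψ hψ =>
    intro f p j k h1 h2 h3
    obtain ⟨j', k', h1', h2', h3'⟩ := hstep f ψ p j k hψ h1 h2 h3
    have := hfinal (f ≫ ψ) (p + 1) j' k' h1' h2' h3'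
    omega
  | cons ψ χ n hψ _ ih =>
    intro f p j k h1 h2 h3
    obtain ⟨j', k', h1', h2', h3'⟩ := hstep f ψ p j k hψ h1 h2 h3
    have := ih (f ≫ ψ) (p + 1) j' k' h1' h2' h3'
    omega

/-- **[FrdII] Prop. 3.4 (viii), the chain count (p. 33 ll. 3–15), abstract form.** Let `G : F ⥤ D`,
`H : F ⥤ F₀` be functors such that (vi) every FSMI-morphism of `F` maps under `G` to an isomorphism or
an FSMI-morphism of `D`, and (iv) every FSMI-morphism of `F` that maps to an isomorphism of `D` maps
under `H` to an FSMI-morphism of `F₀`. If the composites out of `G A` in `D` with arbitrary head and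
FSMI tail have length `≤ N_D`, and those out of `H A` in `F₀` have length `≤ N₀` (condition (b) of
"FSMFF-type" in the author's 2024 revision, at these two objects), then every composite out of `A` in
`F` with arbitrary head and FSMI tail has length `≤ N_D · N₀`.
[cite: MochizukiFrdII2008, Prop 3.4 (viii) p.33] -/
theorem IsHeadedFSMIChain.length_le_of_functors
    (hVI : ∀ {X Y : F} (φ : X ⟶ Y), IsFSMI φ → IsIso (G.map φ) ∨ IsFSMI (G.map φ))
    (hIV : ∀ {X Y : F} (φ : X ⟶ Y), IsFSMI φ → IsIso (G.map φ) → IsFSMI (H.map φ))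
    (A : F) {N_D N₀ : ℕ}
    (hD : ∀ {B : D} (φ : G.obj A ⟶ B) (n : ℕ), IsHeadedFSMIChain ⊤ φ n → n ≤ N_D)
    (h₀ : ∀ {B : F₀} (φ : H.obj A ⟶ B) (n : ℕ), IsHeadedFSMIChain ⊤ φ n → n ≤ N₀)
    {B : F} {φ : A ⟶ B} {n : ℕ} (hφ : IsHeadedFSMIChain ⊤ φ n) : n ≤ N_D * N₀ := by
  cases hφ with
  | single φ _ =>
    exact Nat.mul_le_mul (one_le_of_headedChain_bound hD) (one_le_of_headedChain_bound h₀)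
  | comp φ₁ χ m _ hχ =>
    have h := transfer_aux G H hVI hIV A hD h₀ hχ φ₁ 0 0 0
      (IsHeadedFSMIChain.single _ (MorphismProperty.top_apply _)) (Or.inl rfl) (Nat.zero_le _)
    omega

/-- **[FrdII] Prop. 3.4 (viii), the chain count, existential form**: under (vi) and (iv) as above,
bounds for the headed chains out of `G A` in `D` and out of `H A` in `F₀` yield a bound for the headed
chains out of `A` in `F` — condition (b) of "FSMFF-type" (revised) at `A`.
[cite: MochizukiFrdII2008, Prop 3.4 (viii) p.33] -/
theorem IsHeadedFSMIChain.exists_bound_of_functors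
    (hVI : ∀ {X Y : F} (φ : X ⟶ Y), IsFSMI φ → IsIso (G.map φ) ∨ IsFSMI (G.map φ))
    (hIV : ∀ {X Y : F} (φ : X ⟶ Y), IsFSMI φ → IsIso (G.map φ) → IsFSMI (H.map φ))
    (A : F)
    (hD : ∃ N : ℕ, ∀ {B : D} (φ : G.obj A ⟶ B) (n : ℕ), IsHeadedFSMIChain ⊤ φ n → n ≤ N)
    (h₀ : ∃ N : ℕ, ∀ {B : F₀} (φ : H.obj A ⟶ B) (n : ℕ), IsHeadedFSMIChain ⊤ φ n → n ≤ N) :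
    ∃ N : ℕ, ∀ {B : F} (φ : A ⟶ B) (n : ℕ), IsHeadedFSMIChain ⊤ φ n → n ≤ N := by
  obtain ⟨N_D, hD⟩ := hD
  obtain ⟨N₀, h₀⟩ := h₀
  exact ⟨N_D * N₀, fun φ n hφ => hφ.length_le_of_functors G H hVI hIV A hD h₀⟩

/-- **[FrdII] Prop. 3.4 (viii), "`F` is of FSMFF-type" assembled from its printed inputs** (revised
notion): if `D` is of FSMFF-type (2024), the headed chains of `F₀` are bounded at every object
(condition (b) for `F₀`), (vi) and (iv) hold in the FSMI form above, and (a) every non-invertible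
FSM-morphism of `F` is a composite of FSMI-morphisms, then `F` is of FSMFF-type (2024).
[cite: MochizukiFrdII2008, Prop 3.4 (viii) p.33] -/
theorem IsOfFSMFFType2024.of_functors
    (hVI : ∀ {X Y : F} (φ : X ⟶ Y), IsFSMI φ → IsIso (G.map φ) ∨ IsFSMI (G.map φ))
    (hIV : ∀ {X Y : F} (φ : X ⟶ Y), IsFSMI φ → IsIso (G.map φ) → IsFSMI (H.map φ))
    (hD : IsOfFSMFFType2024 D)
    (h₀ : ∀ A₀ : F₀, ∃ N : ℕ, ∀ {B : F₀} (φ : A₀ ⟶ B) (n : ℕ), IsHeadedFSMIChain ⊤ φ n → n ≤ N)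
    (ha : ∀ {A B : F} (φ : A ⟶ B), IsFSM φ → ¬ IsIso φ → ∃ n, IsFSMIChain φ n) :
    IsOfFSMFFType2024 F where
  factors := ha
  bounded A :=
    IsHeadedFSMIChain.exists_bound_of_functors G H hVI hIV A (hD.bounded (G.obj A)) (h₀ (H.obj A))

end Transfer

/-! ### The tower of Proposition 3.4 -/

namespace ArchFrd

namespace Tower

universe v u

variable {D : Type u} [Category.{v} D] {π : D ⥤ D0} (T : Tower π)

/-- The FSMI half of the typed item (iv) of a tower, with its hypothesis "`D` is complexifiable"
supplied: an FSMI-morphism of `F` projecting to an isomorphism of `D` projects to an FSMI-morphism of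
`F₀`. [cite: MochizukiFrdII2008, Prop 3.4 (iv) p.30] -/
theorem isFSMI_toF0_of_propIV (hIV : T.PropIV) (hc : RC.IsComplexifiable (π ⋙ D0.toArchBase))
    {X Y : T.F} (φ : X ⟶ Y) (hφ : IsFSMI φ) (hiso : IsIso (T.toD.map φ)) :
    IsFSMI (T.toF0.map φ) :=
  (hIV hc φ hiso).2 hφ

/-- **[FrdII] Prop. 3.4 (viii), chain count for a tower** (`F ∈ {A, N, R}` over `π : D → D₀`): from
the "in particular" clause of (vi) for FSMI-morphisms, the FSMI half of (iv), a bound `N_D` for the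
headed chains out of the image of `A` in `D` and a bound `N₀` for those out of its image in `F₀`, every
composite out of `A` in `F` with arbitrary head and FSMI tail has length `≤ N_D · N₀`.
[cite: MochizukiFrdII2008, Prop 3.4 (viii) p.33] -/
theorem headedChain_length_le (hVI : T.PropVI_FSMI)
    (hIV : ∀ {X Y : T.F} (φ : X ⟶ Y), IsFSMI φ → IsIso (T.toD.map φ) → IsFSMI (T.toF0.map φ))
    (A : T.F) {N_D N₀ : ℕ}
    (hD : ∀ {B : D} (φ : T.toD.obj A ⟶ B) (n : ℕ), IsHeadedFSMIChain ⊤ φ n → n ≤ N_D)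
    (h₀ : ∀ {B : T.F0} (φ : T.toF0.obj A ⟶ B) (n : ℕ), IsHeadedFSMIChain ⊤ φ n → n ≤ N₀)
    {B : T.F} {φ : A ⟶ B} {n : ℕ} (hφ : IsHeadedFSMIChain ⊤ φ n) : n ≤ N_D * N₀ :=
  hφ.length_le_of_functors T.toD T.toF0 (fun φ hφ => hVI φ hφ) (fun φ hφ hiso => hIV φ hφ hiso)
    A hD h₀

/-- **[FrdII] Prop. 3.4 (viii), condition (b) for a tower `F`**: if the headed chains of `D` are
bounded at the image of every object of `F` and those of `F₀` are bounded at the image of every object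
of `F` (condition (b), revised, for `D` and for `F₀` — only at images, so that e.g. in the complex
regime only COMPLEX objects of `F₀` are concerned), then — given the FSMI clause of (vi) and the FSMI
half of (iv) — the headed chains of `F` are bounded at every object.
[cite: MochizukiFrdII2008, Prop 3.4 (viii) p.33] -/
theorem exists_headedChain_bound (hVI : T.PropVI_FSMI)
    (hIV : ∀ {X Y : T.F} (φ : X ⟶ Y), IsFSMI φ → IsIso (T.toD.map φ) → IsFSMI (T.toF0.map φ))
    (hD : ∀ A : T.F, ∃ N : ℕ, ∀ {B : D} (φ : T.toD.obj A ⟶ B) (n : ℕ),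
      IsHeadedFSMIChain ⊤ φ n → n ≤ N)
    (h₀ : ∀ A : T.F, ∃ N : ℕ, ∀ {B : T.F0} (φ : T.toF0.obj A ⟶ B) (n : ℕ),
      IsHeadedFSMIChain ⊤ φ n → n ≤ N)
    (A : T.F) :
    ∃ N : ℕ, ∀ {B : T.F} (φ : A ⟶ B) (n : ℕ), IsHeadedFSMIChain ⊤ φ n → n ≤ N :=
  IsHeadedFSMIChain.exists_bound_of_functors T.toD T.toF0 (fun φ hφ => hVI φ hφ)
    (fun φ hφ hiso => hIV φ hφ hiso) A (hD A) (h₀ A)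

/-- **[FrdII] Prop. 3.4 (viii), "`F` is of FSMFF-type" for a tower, in the revised (2024) sense**, from
its printed inputs taken by name: `D` of FSMFF-type (2024); condition (b) for `F₀` at the images of
the objects of `F` (the portion of (viii) concerning `F₀`, p. 32); the FSMI clause of (vi); the FSMI
half of (iv); and condition (a) for `F` (finite factorisation of non-invertible FSM-morphisms of `F`,
p. 33 ll. 16–44).
[cite: MochizukiFrdII2008, Prop 3.4 (viii) p.33] -/
theorem isOfFSMFFType2024_of_chainBounds (hVI : T.PropVI_FSMI)
    (hIV : ∀ {X Y : T.F} (φ : X ⟶ Y), IsFSMI φ → IsIso (T.toD.map φ) → IsFSMI (T.toF0.map φ))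
    (hD : IsOfFSMFFType2024 D)
    (h₀ : ∀ A : T.F, ∃ N : ℕ, ∀ {B : T.F0} (φ : T.toF0.obj A ⟶ B) (n : ℕ),
      IsHeadedFSMIChain ⊤ φ n → n ≤ N)
    (ha : ∀ {A B : T.F} (φ : A ⟶ B), IsFSM φ → ¬ IsIso φ → ∃ n, IsFSMIChain φ n) :
    IsOfFSMFFType2024 T.F where
  factors := ha
  bounded A := T.exists_headedChain_bound hVI hIV (fun _ => hD.bounded _) h₀ A

/-- **[FrdII] Prop. 3.4 (viii), the conjunct "`F` is of FSMFF-type" of the typed item `T.PropVIII`**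
(2008 notion, `IsOfFSMFFType T.F`), from the same inputs — the revised notion implies the printed one
(`IsOfFSMFFType2024.isOfFSMFFType`). [cite: MochizukiFrdII2008, Prop 3.4 (viii) p.30] -/
theorem isOfFSMFFType_of_chainBounds (hVI : T.PropVI_FSMI)
    (hIV : ∀ {X Y : T.F} (φ : X ⟶ Y), IsFSMI φ → IsIso (T.toD.map φ) → IsFSMI (T.toF0.map φ))
    (hD : IsOfFSMFFType2024 D)
    (h₀ : ∀ A : T.F, ∃ N : ℕ, ∀ {B : T.F0} (φ : T.toF0.obj A ⟶ B) (n : ℕ),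
      IsHeadedFSMIChain ⊤ φ n → n ≤ N)
    (ha : ∀ {A B : T.F} (φ : A ⟶ B), IsFSM φ → ¬ IsIso φ → ∃ n, IsFSMIChain φ n) :
    IsOfFSMFFType T.F :=
  (T.isOfFSMFFType2024_of_chainBounds hVI hIV hD h₀ ha).isOfFSMFFType

/-- The same packaging with (iv) in its typed form `T.PropIV` and "`D` is complexifiable" (the first
hypothesis of the typed item (viii)). [cite: MochizukiFrdII2008, Prop 3.4 (viii) p.30] -/
theorem isOfFSMFFType_of_propIV_of_chainBounds (hVI : T.PropVI_FSMI) (hIV : T.PropIV)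
    (hc : RC.IsComplexifiable (π ⋙ D0.toArchBase)) (hD : IsOfFSMFFType2024 D)
    (h₀ : ∀ A : T.F, ∃ N : ℕ, ∀ {B : T.F0} (φ : T.toF0.obj A ⟶ B) (n : ℕ),
      IsHeadedFSMIChain ⊤ φ n → n ≤ N)
    (ha : ∀ {A B : T.F} (φ : A ⟶ B), IsFSM φ → ¬ IsIso φ → ∃ n, IsFSMIChain φ n) :
    IsOfFSMFFType T.F :=
  T.isOfFSMFFType_of_chainBounds hVI (fun φ hφ hiso => T.isFSMI_toF0_of_propIV hIV hc φ hφ hiso)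
    hD h₀ ha

end Tower

end ArchFrd

end Literature.AlgebraicGeometry.Frobenioids
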